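import Summits.CriticalPhenomena.PercolationContinuityZ3.Theorems.PercNearOneGluingNoHeavyLowerTailWorstPairExchangeCex
import HarnessLib

/-!
# `NoHeavyLowerTail` (stmt-CriticalPhenomena-4575) — the PURE T-FORM gluing property is FALSE
# (certified 7-vertex, 12-pair witness): the `∀ c` in GLUE-ADM's singleton hypothesis is essential

Support file (prover `prim-hp-5`, hull-port cell, T-form calculus, gen 4; `--supports stmt-CriticalPhenomena-4575`).
Computational (`native_decide` on `2¹²`-term exact rational sums; evaluation pattern of
`PercNearOneGluingNoHeavyLowerTailLocalizedSelectionCex.lean`).  No definitions, no named facts, no sorries.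

**Background.**  `Theorems.noHeavyLowerTail_of_gluedWitness₂` (file `…TformGluedWitness.lean`) reduces the crux to the
champion-free gluing property GLUE-ADM: a relay `x` that is a T-witness for every member `y` of a set `B` of non-relays
(for EVERY relay `c`: `μ(1 ≤ N_y ≤ j) + μ(N_c ≤ j) ≤ μ(N_c ≤ j ∧ 1 ≤ N_y) + μ(N_x ≤ j)`) is a T-witness for the glued set.
GLUE-ADM has no violation in ttrl2's exhaustive exact census `n ≤ 7` (20.1 M member-witness cases; run/shared/lean/ttrl/tcs/GLUEADM.md).
The tempting simplification that keeps ONLY the comparison relay `c = x` on both sides ("pure T-form": `x` at least as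
light as each member ⟹ at least as light as the glued observer) is FALSE, by a hair:

**Witness** (ttrl2 / cp-swap, `tcs/glue/UB_counterexample.json`; the seat's exact evaluator agrees rational for rational):
`Fin 7`, relays `A = {0,1,2,3}`, members `B = {4,5}`, Steiner vertex `6`, level `j = 2`, `x = 0`; pair weights (twentieths)
`0-2:14 0-3:1 0-4:9 0-6:19 1-3:5 1-6:5 2-3:17 2-4:3 2-5:3 4-5:7 4-6:10 5-6:14`, all other pairs `0`.  Exactly:
`μ(N_0 ≤ 2 ∧ 1 ≤ N_4) − μ(1 ≤ N_4 ≤ 2) = 2416906107/4096·10⁹ > 0`, `μ(N_0 ≤ 2 ∧ 1 ≤ N_5) − μ(1 ≤ N_5 ≤ 2) = 6590877/4096·10⁸ > 0`, but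
`μ(0 ≁ B, N_0 ≤ 2) − μ(0 ≁ B, 1 ≤ N_B ≤ 2) − μ(N_B = 0, N_0 ≤ 2) = −1290201/2048·10⁸ < 0` (`N_B = |π(4) ∪ π(5)|`).
(At this witness the full GLUE-ADM hypothesis fails at `c = 1`, so it is not a GLUE-ADM counterexample.)

* `GluedWitnessTformCex.real_*` — the five masses as exact weighted counts;  `gluedWitnessTform_cex` — the instance;
* `not_gluedWitness_Tform` — `¬`(pure T-form gluing) over all finite weighted graphs: the statement obtained from the hypothesis
  `hGlue` of `noHeavyLowerTail_of_gluedWitness₂` by replacing "for every relay `c`" with `c = x` in hypothesis and conclusion.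
-/

namespace Summit.CriticalPhenomena.PercolationContinuityZ3.Theorems

open MeasureTheory
open Literature.Probability.LatticeModels Literature.Probability.Percolation
open Summit.CriticalPhenomena.PercolationContinuityZ3.Theorems.AdditiveGluing.Negative.Cert
open scoped Classical

set_option maxHeartbeats 400000

namespace GluedWitnessTformCex

open WorstPairExchangeCex (real_eq_wcount)

/-- The relay count of a cluster read off the reach table (relays `{0,1,2,3}` of `Fin 7`). [this file] -/
theorem cnt_reachTable (ω : List (Fin 7 × Fin 7)) (v : Fin 7) :
    ((({0, 1, 2, 3} : Finset (Fin 7))).filter fun q : Fin 7 => ((reachTable 7 ω).getD v.val 0).testBit q.val = true).card =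
      ((({0, 1, 2, 3} : Finset (Fin 7))).filter fun q => (↑(Eset ω) : Set (Sym2 (Fin 7))) ∈ openConn v q).card := by
  congr 1
  exact Finset.filter_congr fun q _ => testBit_reachTable_iff_mem_openConn ω v q

/-- The relay count of the union of the clusters of the members `4, 5` read off the reach table. [this file] -/
theorem cnt_reachTable_B (ω : List (Fin 7 × Fin 7)) :
    ((({0, 1, 2, 3} : Finset (Fin 7))).filter fun q : Fin 7 =>
        (((reachTable 7 ω).getD 4 0).testBit q.val || ((reachTable 7 ω).getD 5 0).testBit q.val) = true).card =
      ((({0, 1, 2, 3} : Finset (Fin 7))).filter fun q =>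
        ∃ y ∈ ({4, 5} : Finset (Fin 7)), (↑(Eset ω) : Set (Sym2 (Fin 7))) ∈ openConn y q).card := by
  congr 1
  refine Finset.filter_congr fun q _ => ?_
  have h4 : ((reachTable 7 ω).getD 4 0).testBit q.val = true ↔ (↑(Eset ω) : Set (Sym2 (Fin 7))) ∈ openConn (4 : Fin 7) q :=
    testBit_reachTable_iff_mem_openConn ω 4 q
  have h5 : ((reachTable 7 ω).getD 5 0).testBit q.val = true ↔ (↑(Eset ω) : Set (Sym2 (Fin 7))) ∈ openConn (5 : Fin 7) q :=
    testBit_reachTable_iff_mem_openConn ω 5 q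
  rw [Bool.or_eq_true, h4, h5]
  simp only [Finset.mem_insert, Finset.mem_singleton, exists_eq_or_imp, exists_eq_left]

/-- `μ(1 ≤ N_y ≤ 2)` as an exact weighted count. [this file] -/
theorem real_L {l : List (Fin 7 × Fin 7 × ℚ)} (hnd : (wPairs l).Nodup) (hq : ∀ e ∈ l, 0 ≤ e.2.2 ∧ e.2.2 ≤ 1) (y : Fin 7) :
    (prodBernoulli (wOfList l)).real
        {ω : BondConfig (Fin 7) | 1 ≤ ((({0, 1, 2, 3} : Finset (Fin 7))).filter fun q => ω ∈ openConn y q).card ∧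
          ((({0, 1, 2, 3} : Finset (Fin 7))).filter fun q => ω ∈ openConn y q).card ≤ 2} =
      ((((wtabs 7 l).map fun t => if
          (Nat.ble 1 (((({0, 1, 2, 3} : Finset (Fin 7))).filter fun q : Fin 7 => ((t.1).getD y.val 0).testBit q.val = true).card) &&
            Nat.ble (((({0, 1, 2, 3} : Finset (Fin 7))).filter fun q : Fin 7 => ((t.1).getD y.val 0).testBit q.val = true).card) 2)
          then t.2 else 0).sum : ℚ) : ℝ) := by
  refine real_eq_wcount hnd hq (fun tb =>
      Nat.ble 1 (((({0, 1, 2, 3} : Finset (Fin 7))).filter fun q : Fin 7 => ((tb).getD y.val 0).testBit q.val = true).card) &&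
        Nat.ble (((({0, 1, 2, 3} : Finset (Fin 7))).filter fun q : Fin 7 => ((tb).getD y.val 0).testBit q.val = true).card) 2) _
    fun ω => ?_
  rw [cnt_reachTable ω y, Bool.and_eq_true, Nat.ble_eq, Nat.ble_eq, Set.mem_setOf_eq]

/-- `μ(N_0 ≤ 2 ∧ 1 ≤ N_y)` as an exact weighted count. [this file] -/
theorem real_RA {l : List (Fin 7 × Fin 7 × ℚ)} (hnd : (wPairs l).Nodup) (hq : ∀ e ∈ l, 0 ≤ e.2.2 ∧ e.2.2 ≤ 1) (y : Fin 7) :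
    (prodBernoulli (wOfList l)).real
        {ω : BondConfig (Fin 7) | ((({0, 1, 2, 3} : Finset (Fin 7))).filter fun q => ω ∈ openConn (0 : Fin 7) q).card ≤ 2 ∧
          1 ≤ ((({0, 1, 2, 3} : Finset (Fin 7))).filter fun q => ω ∈ openConn y q).card} =
      ((((wtabs 7 l).map fun t => if
          (Nat.ble (((({0, 1, 2, 3} : Finset (Fin 7))).filter fun q : Fin 7 => ((t.1).getD 0 0).testBit q.val = true).card) 2 &&
            Nat.ble 1 (((({0, 1, 2, 3} : Finset (Fin 7))).filter fun q : Fin 7 => ((t.1).getD y.val 0).testBit q.val = true).card))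
          then t.2 else 0).sum : ℚ) : ℝ) := by
  refine real_eq_wcount hnd hq (fun tb =>
      Nat.ble (((({0, 1, 2, 3} : Finset (Fin 7))).filter fun q : Fin 7 => ((tb).getD 0 0).testBit q.val = true).card) 2 &&
        Nat.ble 1 (((({0, 1, 2, 3} : Finset (Fin 7))).filter fun q : Fin 7 => ((tb).getD y.val 0).testBit q.val = true).card)) _
    fun ω => ?_
  have h0 := cnt_reachTable ω 0
  simp only [Fin.val_zero] at h0
  rw [h0, cnt_reachTable ω y, Bool.and_eq_true, Nat.ble_eq, Nat.ble_eq, Set.mem_setOf_eq]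

/-- `μ(N_0 ≤ 2)` as an exact weighted count. [this file] -/
theorem real_R0 {l : List (Fin 7 × Fin 7 × ℚ)} (hnd : (wPairs l).Nodup) (hq : ∀ e ∈ l, 0 ≤ e.2.2 ∧ e.2.2 ≤ 1) :
    (prodBernoulli (wOfList l)).real
        {ω : BondConfig (Fin 7) | ((({0, 1, 2, 3} : Finset (Fin 7))).filter fun q => ω ∈ openConn (0 : Fin 7) q).card ≤ 2} =
      ((((wtabs 7 l).map fun t => if
          Nat.ble (((({0, 1, 2, 3} : Finset (Fin 7))).filter fun q : Fin 7 => ((t.1).getD 0 0).testBit q.val = true).card) 2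
          then t.2 else 0).sum : ℚ) : ℝ) := by
  refine real_eq_wcount hnd hq (fun tb =>
      Nat.ble (((({0, 1, 2, 3} : Finset (Fin 7))).filter fun q : Fin 7 => ((tb).getD 0 0).testBit q.val = true).card) 2) _
    fun ω => ?_
  have h0 := cnt_reachTable ω 0
  simp only [Fin.val_zero] at h0
  rw [h0, Nat.ble_eq, Set.mem_setOf_eq]

/-- `μ(0 ≁ B, 1 ≤ N_B ≤ 2)` (`B = {4,5}`) as an exact weighted count. [this file] -/
theorem real_Q1 {l : List (Fin 7 × Fin 7 × ℚ)} (hnd : (wPairs l).Nodup) (hq : ∀ e ∈ l, 0 ≤ e.2.2 ∧ e.2.2 ≤ 1) :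
    (prodBernoulli (wOfList l)).real
        {ω : BondConfig (Fin 7) | (∀ y ∈ ({4, 5} : Finset (Fin 7)), ω ∉ openConn (0 : Fin 7) y) ∧
          1 ≤ ((({0, 1, 2, 3} : Finset (Fin 7))).filter fun q => ∃ y ∈ ({4, 5} : Finset (Fin 7)), ω ∈ openConn y q).card ∧
          ((({0, 1, 2, 3} : Finset (Fin 7))).filter fun q => ∃ y ∈ ({4, 5} : Finset (Fin 7)), ω ∈ openConn y q).card ≤ 2} =
      ((((wtabs 7 l).map fun t => if
          (!((t.1).getD 0 0).testBit 4 && !((t.1).getD 0 0).testBit 5 &&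
            Nat.ble 1 (((({0, 1, 2, 3} : Finset (Fin 7))).filter fun q : Fin 7 =>
              (((t.1).getD 4 0).testBit q.val || ((t.1).getD 5 0).testBit q.val) = true).card) &&
            Nat.ble (((({0, 1, 2, 3} : Finset (Fin 7))).filter fun q : Fin 7 =>
              (((t.1).getD 4 0).testBit q.val || ((t.1).getD 5 0).testBit q.val) = true).card) 2)
          then t.2 else 0).sum : ℚ) : ℝ) := by
  refine real_eq_wcount hnd hq (fun tb =>
      !((tb).getD 0 0).testBit 4 && !((tb).getD 0 0).testBit 5 &&
        Nat.ble 1 (((({0, 1, 2, 3} : Finset (Fin 7))).filter fun q : Fin 7 =>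
          (((tb).getD 4 0).testBit q.val || ((tb).getD 5 0).testBit q.val) = true).card) &&
        Nat.ble (((({0, 1, 2, 3} : Finset (Fin 7))).filter fun q : Fin 7 =>
          (((tb).getD 4 0).testBit q.val || ((tb).getD 5 0).testBit q.val) = true).card) 2) _
    fun ω => ?_
  have h04 : ((reachTable 7 ω).getD 0 0).testBit 4 = true ↔ (↑(Eset ω) : Set (Sym2 (Fin 7))) ∈ openConn (0 : Fin 7) (4 : Fin 7) :=
    testBit_reachTable_iff_mem_openConn ω 0 4
  have h05 : ((reachTable 7 ω).getD 0 0).testBit 5 = true ↔ (↑(Eset ω) : Set (Sym2 (Fin 7))) ∈ openConn (0 : Fin 7) (5 : Fin 7) :=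
    testBit_reachTable_iff_mem_openConn ω 0 5
  have n04 : ((reachTable 7 ω).getD 0 0).testBit 4 = false ↔ (↑(Eset ω) : Set (Sym2 (Fin 7))) ∉ openConn (0 : Fin 7) (4 : Fin 7) := by
    rw [Bool.eq_false_iff, ne_eq, h04]
  have n05 : ((reachTable 7 ω).getD 0 0).testBit 5 = false ↔ (↑(Eset ω) : Set (Sym2 (Fin 7))) ∉ openConn (0 : Fin 7) (5 : Fin 7) := by
    rw [Bool.eq_false_iff, ne_eq, h05]
  rw [cnt_reachTable_B ω]
  simp only [Bool.and_eq_true, Bool.not_eq_true', Nat.ble_eq, Set.mem_setOf_eq, n04, n05, Finset.mem_insert,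
    Finset.mem_singleton, forall_eq_or_imp, forall_eq]
  simp only [and_assoc]

/-- `μ(N_B = 0, N_0 ≤ 2)` (`B = {4,5}`) as an exact weighted count. [this file] -/
theorem real_Q2 {l : List (Fin 7 × Fin 7 × ℚ)} (hnd : (wPairs l).Nodup) (hq : ∀ e ∈ l, 0 ≤ e.2.2 ∧ e.2.2 ≤ 1) :
    (prodBernoulli (wOfList l)).real
        {ω : BondConfig (Fin 7) |
          ¬ 1 ≤ ((({0, 1, 2, 3} : Finset (Fin 7))).filter fun q => ∃ y ∈ ({4, 5} : Finset (Fin 7)), ω ∈ openConn y q).card ∧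
          ((({0, 1, 2, 3} : Finset (Fin 7))).filter fun q => ω ∈ openConn (0 : Fin 7) q).card ≤ 2} =
      ((((wtabs 7 l).map fun t => if
          (!(Nat.ble 1 (((({0, 1, 2, 3} : Finset (Fin 7))).filter fun q : Fin 7 =>
              (((t.1).getD 4 0).testBit q.val || ((t.1).getD 5 0).testBit q.val) = true).card)) &&
            Nat.ble (((({0, 1, 2, 3} : Finset (Fin 7))).filter fun q : Fin 7 => ((t.1).getD 0 0).testBit q.val = true).card) 2)
          then t.2 else 0).sum : ℚ) : ℝ) := by
  refine real_eq_wcount hnd hq (fun tb =>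
      !(Nat.ble 1 (((({0, 1, 2, 3} : Finset (Fin 7))).filter fun q : Fin 7 =>
          (((tb).getD 4 0).testBit q.val || ((tb).getD 5 0).testBit q.val) = true).card)) &&
        Nat.ble (((({0, 1, 2, 3} : Finset (Fin 7))).filter fun q : Fin 7 => ((tb).getD 0 0).testBit q.val = true).card) 2) _
    fun ω => ?_
  have h0 := cnt_reachTable ω 0
  simp only [Fin.val_zero] at h0
  rw [cnt_reachTable_B ω, h0]
  simp only [Bool.and_eq_true, Bool.not_eq_true', Nat.ble_eq, Set.mem_setOf_eq, Bool.eq_false_iff, ne_eq]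

/-- `μ(0 ≁ B, N_0 ≤ 2)` (`B = {4,5}`) as an exact weighted count. [this file] -/
theorem real_Q3 {l : List (Fin 7 × Fin 7 × ℚ)} (hnd : (wPairs l).Nodup) (hq : ∀ e ∈ l, 0 ≤ e.2.2 ∧ e.2.2 ≤ 1) :
    (prodBernoulli (wOfList l)).real
        {ω : BondConfig (Fin 7) | (∀ y ∈ ({4, 5} : Finset (Fin 7)), ω ∉ openConn (0 : Fin 7) y) ∧
          ((({0, 1, 2, 3} : Finset (Fin 7))).filter fun q => ω ∈ openConn (0 : Fin 7) q).card ≤ 2} =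
      ((((wtabs 7 l).map fun t => if
          (!((t.1).getD 0 0).testBit 4 && !((t.1).getD 0 0).testBit 5 &&
            Nat.ble (((({0, 1, 2, 3} : Finset (Fin 7))).filter fun q : Fin 7 => ((t.1).getD 0 0).testBit q.val = true).card) 2)
          then t.2 else 0).sum : ℚ) : ℝ) := by
  refine real_eq_wcount hnd hq (fun tb =>
      !((tb).getD 0 0).testBit 4 && !((tb).getD 0 0).testBit 5 &&
        Nat.ble (((({0, 1, 2, 3} : Finset (Fin 7))).filter fun q : Fin 7 => ((tb).getD 0 0).testBit q.val = true).card) 2) _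
    fun ω => ?_
  have h04 : ((reachTable 7 ω).getD 0 0).testBit 4 = true ↔ (↑(Eset ω) : Set (Sym2 (Fin 7))) ∈ openConn (0 : Fin 7) (4 : Fin 7) :=
    testBit_reachTable_iff_mem_openConn ω 0 4
  have h05 : ((reachTable 7 ω).getD 0 0).testBit 5 = true ↔ (↑(Eset ω) : Set (Sym2 (Fin 7))) ∈ openConn (0 : Fin 7) (5 : Fin 7) :=
    testBit_reachTable_iff_mem_openConn ω 0 5
  have n04 : ((reachTable 7 ω).getD 0 0).testBit 4 = false ↔ (↑(Eset ω) : Set (Sym2 (Fin 7))) ∉ openConn (0 : Fin 7) (4 : Fin 7) := by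
    rw [Bool.eq_false_iff, ne_eq, h04]
  have n05 : ((reachTable 7 ω).getD 0 0).testBit 5 = false ↔ (↑(Eset ω) : Set (Sym2 (Fin 7))) ∉ openConn (0 : Fin 7) (5 : Fin 7) := by
    rw [Bool.eq_false_iff, ne_eq, h05]
  have h0 := cnt_reachTable ω 0
  simp only [Fin.val_zero] at h0
  rw [h0]
  simp only [Bool.and_eq_true, Bool.not_eq_true', Nat.ble_eq, Set.mem_setOf_eq, n04, n05, Finset.mem_insert,
    Finset.mem_singleton, forall_eq_or_imp, forall_eq]

/-- **From three checkable rational facts to the violating instance** (`Fin 7`, relays `{0,1,2,3}`, `B = {4,5}`, `x = 0`,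
`j = 2`): the two singleton T-form inequalities hold and the glued one fails. [this file] -/
theorem violation_of_checks (l : List (Fin 7 × Fin 7 × ℚ)) (hnd : (wPairs l).Nodup) (hq : ∀ e ∈ l, 0 ≤ e.2.2 ∧ e.2.2 ≤ 1)
    (h4 : ((wtabs 7 l).map fun t => if
          (Nat.ble 1 (((({0, 1, 2, 3} : Finset (Fin 7))).filter fun q : Fin 7 => ((t.1).getD (4 : Fin 7).val 0).testBit q.val = true).card) &&
            Nat.ble (((({0, 1, 2, 3} : Finset (Fin 7))).filter fun q : Fin 7 => ((t.1).getD (4 : Fin 7).val 0).testBit q.val = true).card) 2)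
          then t.2 else 0).sum ≤
        ((wtabs 7 l).map fun t => if
          (Nat.ble (((({0, 1, 2, 3} : Finset (Fin 7))).filter fun q : Fin 7 => ((t.1).getD 0 0).testBit q.val = true).card) 2 &&
            Nat.ble 1 (((({0, 1, 2, 3} : Finset (Fin 7))).filter fun q : Fin 7 => ((t.1).getD (4 : Fin 7).val 0).testBit q.val = true).card))
          then t.2 else 0).sum)
    (h5 : ((wtabs 7 l).map fun t => if
          (Nat.ble 1 (((({0, 1, 2, 3} : Finset (Fin 7))).filter fun q : Fin 7 => ((t.1).getD (5 : Fin 7).val 0).testBit q.val = true).card) &&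
            Nat.ble (((({0, 1, 2, 3} : Finset (Fin 7))).filter fun q : Fin 7 => ((t.1).getD (5 : Fin 7).val 0).testBit q.val = true).card) 2)
          then t.2 else 0).sum ≤
        ((wtabs 7 l).map fun t => if
          (Nat.ble (((({0, 1, 2, 3} : Finset (Fin 7))).filter fun q : Fin 7 => ((t.1).getD 0 0).testBit q.val = true).card) 2 &&
            Nat.ble 1 (((({0, 1, 2, 3} : Finset (Fin 7))).filter fun q : Fin 7 => ((t.1).getD (5 : Fin 7).val 0).testBit q.val = true).card))
          then t.2 else 0).sum)
    (hQ : ((wtabs 7 l).map fun t => if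
          (!((t.1).getD 0 0).testBit 4 && !((t.1).getD 0 0).testBit 5 &&
            Nat.ble (((({0, 1, 2, 3} : Finset (Fin 7))).filter fun q : Fin 7 => ((t.1).getD 0 0).testBit q.val = true).card) 2)
          then t.2 else 0).sum <
        ((wtabs 7 l).map fun t => if
          (!((t.1).getD 0 0).testBit 4 && !((t.1).getD 0 0).testBit 5 &&
            Nat.ble 1 (((({0, 1, 2, 3} : Finset (Fin 7))).filter fun q : Fin 7 =>
              (((t.1).getD 4 0).testBit q.val || ((t.1).getD 5 0).testBit q.val) = true).card) &&
            Nat.ble (((({0, 1, 2, 3} : Finset (Fin 7))).filter fun q : Fin 7 =>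
              (((t.1).getD 4 0).testBit q.val || ((t.1).getD 5 0).testBit q.val) = true).card) 2)
          then t.2 else 0).sum +
        ((wtabs 7 l).map fun t => if
          (!(Nat.ble 1 (((({0, 1, 2, 3} : Finset (Fin 7))).filter fun q : Fin 7 =>
              (((t.1).getD 4 0).testBit q.val || ((t.1).getD 5 0).testBit q.val) = true).card)) &&
            Nat.ble (((({0, 1, 2, 3} : Finset (Fin 7))).filter fun q : Fin 7 => ((t.1).getD 0 0).testBit q.val = true).card) 2)
          then t.2 else 0).sum) :
    (∀ y ∈ ({4, 5} : Finset (Fin 7)),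
      (prodBernoulli (wOfList l)).real {ω : BondConfig (Fin 7) |
          1 ≤ ((({0, 1, 2, 3} : Finset (Fin 7))).filter fun z => ω ∈ openConn y z).card ∧
            ((({0, 1, 2, 3} : Finset (Fin 7))).filter fun z => ω ∈ openConn y z).card ≤ 2} +
        (prodBernoulli (wOfList l)).real {ω : BondConfig (Fin 7) |
          ((({0, 1, 2, 3} : Finset (Fin 7))).filter fun z => ω ∈ openConn (0 : Fin 7) z).card ≤ 2} ≤
      (prodBernoulli (wOfList l)).real {ω : BondConfig (Fin 7) |
          ((({0, 1, 2, 3} : Finset (Fin 7))).filter fun z => ω ∈ openConn (0 : Fin 7) z).card ≤ 2 ∧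
            1 ≤ ((({0, 1, 2, 3} : Finset (Fin 7))).filter fun z => ω ∈ openConn y z).card} +
        (prodBernoulli (wOfList l)).real {ω : BondConfig (Fin 7) |
          ((({0, 1, 2, 3} : Finset (Fin 7))).filter fun z => ω ∈ openConn (0 : Fin 7) z).card ≤ 2}) ∧
    ¬ ((prodBernoulli (wOfList l)).real {ω : BondConfig (Fin 7) |
          (∀ y ∈ ({4, 5} : Finset (Fin 7)), ω ∉ openConn (0 : Fin 7) y) ∧
            1 ≤ ((({0, 1, 2, 3} : Finset (Fin 7))).filter fun z => ∃ y ∈ ({4, 5} : Finset (Fin 7)), ω ∈ openConn y z).card ∧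
            ((({0, 1, 2, 3} : Finset (Fin 7))).filter fun z => ∃ y ∈ ({4, 5} : Finset (Fin 7)), ω ∈ openConn y z).card ≤ 2} +
        (prodBernoulli (wOfList l)).real {ω : BondConfig (Fin 7) |
          ¬ 1 ≤ ((({0, 1, 2, 3} : Finset (Fin 7))).filter fun z => ∃ y ∈ ({4, 5} : Finset (Fin 7)), ω ∈ openConn y z).card ∧
            ((({0, 1, 2, 3} : Finset (Fin 7))).filter fun z => ω ∈ openConn (0 : Fin 7) z).card ≤ 2} ≤
      (prodBernoulli (wOfList l)).real {ω : BondConfig (Fin 7) |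
          (∀ y ∈ ({4, 5} : Finset (Fin 7)), ω ∉ openConn (0 : Fin 7) y) ∧
            ((({0, 1, 2, 3} : Finset (Fin 7))).filter fun z => ω ∈ openConn (0 : Fin 7) z).card ≤ 2}) := by
  refine ⟨?_, ?_⟩
  · intro y hy
    simp only [Finset.mem_insert, Finset.mem_singleton] at hy
    rcases hy with rfl | rfl
    · rw [real_L hnd hq (4 : Fin 7), real_RA hnd hq (4 : Fin 7), real_R0 hnd hq]
      exact add_le_add (by exact_mod_cast h4) le_rfl
    · rw [real_L hnd hq (5 : Fin 7), real_RA hnd hq (5 : Fin 7), real_R0 hnd hq]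
      exact add_le_add (by exact_mod_cast h5) le_rfl
  · rw [real_Q1 hnd hq, real_Q2 hnd hq, real_Q3 hnd hq, not_le]
    exact_mod_cast hQ

end GluedWitnessTformCex

open GluedWitnessTformCex in
/-- **The pure T-form gluing property fails: the instance.**  Weights on `Fin 7` (twentieths): `0-2:14 0-3:1 0-4:9 0-6:19 1-3:5
1-6:5 2-3:17 2-4:3 2-5:3 4-5:7 4-6:10 5-6:14`, relays `{0,1,2,3}`, `B = {4,5}`, `x = 0`, `j = 2`: the two singleton T-form
inequalities hold and the glued one fails (exact rationals by `native_decide` over the `2¹²` configurations). [this file] -/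
theorem gluedWitnessTform_cex : ∃ u : Sym2 (Fin 7) → unitInterval,
    (∀ y ∈ ({4, 5} : Finset (Fin 7)),
      (prodBernoulli u).real {ω : BondConfig (Fin 7) |
          1 ≤ ((({0, 1, 2, 3} : Finset (Fin 7))).filter fun z => ω ∈ openConn y z).card ∧
            ((({0, 1, 2, 3} : Finset (Fin 7))).filter fun z => ω ∈ openConn y z).card ≤ 2} +
        (prodBernoulli u).real {ω : BondConfig (Fin 7) |
          ((({0, 1, 2, 3} : Finset (Fin 7))).filter fun z => ω ∈ openConn (0 : Fin 7) z).card ≤ 2} ≤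
      (prodBernoulli u).real {ω : BondConfig (Fin 7) |
          ((({0, 1, 2, 3} : Finset (Fin 7))).filter fun z => ω ∈ openConn (0 : Fin 7) z).card ≤ 2 ∧
            1 ≤ ((({0, 1, 2, 3} : Finset (Fin 7))).filter fun z => ω ∈ openConn y z).card} +
        (prodBernoulli u).real {ω : BondConfig (Fin 7) |
          ((({0, 1, 2, 3} : Finset (Fin 7))).filter fun z => ω ∈ openConn (0 : Fin 7) z).card ≤ 2}) ∧
    ¬ ((prodBernoulli u).real {ω : BondConfig (Fin 7) |
          (∀ y ∈ ({4, 5} : Finset (Fin 7)), ω ∉ openConn (0 : Fin 7) y) ∧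
            1 ≤ ((({0, 1, 2, 3} : Finset (Fin 7))).filter fun z => ∃ y ∈ ({4, 5} : Finset (Fin 7)), ω ∈ openConn y z).card ∧
            ((({0, 1, 2, 3} : Finset (Fin 7))).filter fun z => ∃ y ∈ ({4, 5} : Finset (Fin 7)), ω ∈ openConn y z).card ≤ 2} +
        (prodBernoulli u).real {ω : BondConfig (Fin 7) |
          ¬ 1 ≤ ((({0, 1, 2, 3} : Finset (Fin 7))).filter fun z => ∃ y ∈ ({4, 5} : Finset (Fin 7)), ω ∈ openConn y z).card ∧
            ((({0, 1, 2, 3} : Finset (Fin 7))).filter fun z => ω ∈ openConn (0 : Fin 7) z).card ≤ 2} ≤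
      (prodBernoulli u).real {ω : BondConfig (Fin 7) |
          (∀ y ∈ ({4, 5} : Finset (Fin 7)), ω ∉ openConn (0 : Fin 7) y) ∧
            ((({0, 1, 2, 3} : Finset (Fin 7))).filter fun z => ω ∈ openConn (0 : Fin 7) z).card ≤ 2}) :=
  ⟨_, violation_of_checks
    [((0 : Fin 7), (2 : Fin 7), 14/20), (0, 3, 1/20), (0, 4, 9/20), (0, 6, 19/20), (1, 3, 5/20), (1, 6, 5/20),
      (2, 3, 17/20), (2, 4, 3/20), (2, 5, 3/20), (4, 5, 7/20), (4, 6, 10/20), (5, 6, 14/20)]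
    (by decide)
    (by
      intro e he
      simp only [List.mem_cons, List.not_mem_nil, or_false] at he
      rcases he with rfl | rfl | rfl | rfl | rfl | rfl | rfl | rfl | rfl | rfl | rfl | rfl <;> norm_num)
    (by native_decide) (by native_decide) (by native_decide)⟩

/-- **No-go: the pure T-form of the gluing property is FALSE.**  It is false that for every finite weighted graph, relay set `A`,
relay `x ∈ A`, set `B` of at least two non-relays and level `j`, the singleton T-form inequalities
`μ(1 ≤ N_y ≤ j) + μ(N_x ≤ j) ≤ μ(N_x ≤ j ∧ 1 ≤ N_y) + μ(N_x ≤ j)` (`y ∈ B`) imply the glued one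
`μ(x ≁ B, 1 ≤ N_B ≤ j) + μ(N_B = 0, N_x ≤ j) ≤ μ(x ≁ B, N_x ≤ j)` — i.e. the hypothesis `hGlue` of
`Theorems.noHeavyLowerTail_of_gluedWitness₂` with its comparison relay `c` frozen to `x` on both sides.  (GLUE-ADM itself, with the
singleton inequality for EVERY relay `c`, survives ttrl2's exhaustive census; the `∀ c` is therefore essential.)  Witness
`gluedWitnessTform_cex`. [this file] -/
theorem not_gluedWitness_Tform :
    ¬ (∀ (n : ℕ) (u : Sym2 (Fin n) → unitInterval) (A B : Finset (Fin n)) (x : Fin n) (j : ℕ),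
      x ∈ A → (∀ y ∈ B, y ∉ A) → 2 ≤ B.card →
      (∀ y ∈ B,
        (prodBernoulli u).real {ω : BondConfig (Fin n) |
            1 ≤ (A.filter fun z => ω ∈ openConn y z).card ∧ (A.filter fun z => ω ∈ openConn y z).card ≤ j} +
          (prodBernoulli u).real {ω : BondConfig (Fin n) | (A.filter fun z => ω ∈ openConn x z).card ≤ j} ≤
        (prodBernoulli u).real {ω : BondConfig (Fin n) |
            (A.filter fun z => ω ∈ openConn x z).card ≤ j ∧ 1 ≤ (A.filter fun z => ω ∈ openConn y z).card} +
          (prodBernoulli u).real {ω : BondConfig (Fin n) | (A.filter fun z => ω ∈ openConn x z).card ≤ j}) →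
      (prodBernoulli u).real {ω : BondConfig (Fin n) |
          (∀ y ∈ B, ω ∉ openConn x y) ∧
            1 ≤ (A.filter fun z => ∃ y ∈ B, ω ∈ openConn y z).card ∧
            (A.filter fun z => ∃ y ∈ B, ω ∈ openConn y z).card ≤ j} +
        (prodBernoulli u).real {ω : BondConfig (Fin n) |
          ¬ 1 ≤ (A.filter fun z => ∃ y ∈ B, ω ∈ openConn y z).card ∧
            (A.filter fun z => ω ∈ openConn x z).card ≤ j} ≤
      (prodBernoulli u).real {ω : BondConfig (Fin n) |
          (∀ y ∈ B, ω ∉ openConn x y) ∧ (A.filter fun z => ω ∈ openConn x z).card ≤ j}) := by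
  intro h
  obtain ⟨u, hhyp, hnot⟩ := gluedWitnessTform_cex
  exact hnot (h 7 u ({0, 1, 2, 3} : Finset (Fin 7)) ({4, 5} : Finset (Fin 7)) (0 : Fin 7) 2 (by decide) (by decide)
    (by decide) hhyp)

end Summit.CriticalPhenomena.PercolationContinuityZ3.Theorems
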